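import Summits.Ventures.PercRepro.Decide

/-!
# PercRepro — C-020 = COUNT-NAN3 (mine-2 row M2-8, 08:33:50Z; C-id lead 08:42:18Z): the exact count form of the α₃ / NAN inequality (typer-2, gen 4)

mine-2's row M2-8: for three marks `a, b, c` of a finite multigraph with `m = |E|` edges, the
events `T` (all three connected), `Y` (exactly one pair connected) and `B` (all separated) have
edge-subset level counts `N_w(A) = #{ω ∈ A : |open(ω)| = w}`, and for EVERY level `k`

  `3 · Σ_j N_j(T) · N_{k−j}(B) ≤ Σ_j N_j(Y) · C(m, k − j)`,

i.e. the polynomial `Y(t)·(1 + t)^m − 3·T(t)·B(t)` has nonnegative coefficients (exact on all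
graphs `n ≤ 7` × all 3-markings, 0 violations; ratio 3 attained only at the marked triangle at
level 2). Pure `ℕ` statement (no reals), stated verbatim as suggested (08:34:09Z addendum).

* `levelCount A w` — `N_w(A)`; `allConn3`, `onePair3`, `allSep3` — the events `T`, `Y`, `B` as
  finsets of configurations (decidable through typer-1's `Decide.lean`);
* **`MultiGraph.CountNAN3 G a b c`** — the row for one marked multigraph (all levels `k`);
  **`CountNAN3Upto`** — the levels `k ≤ 2m` only (a `Decidable` instance);
  `countNAN3_iff_upto` — the two agree (levels above `2m` vanish on both sides);
* **`C020`** — the conjecture (CONJECTURES v44 row C-020): every finite multigraph, every three marks;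
* `countNAN3Upto_triangle`, `countNAN3Upto_path2` — the tight instance `K₃` and the path `P₃`
  (marks `0, 1, 2`), decided; `countNAN3_triangle`, `countNAN3_path2` — the whole rows.
-/

namespace PercRepro

open Finset

section Levels

variable {E : Type*} [Fintype E] [DecidableEq E]

/-- The level count `N_w(A)`: configurations of the event `A` with exactly `w` open edges. -/
def levelCount (A : Finset (Config E)) (w : ℕ) : ℕ :=
  (A.filter fun ω => (openEdges ω).card = w).card

omit [DecidableEq E] in
/-- Levels above the number of edges are empty. -/
theorem levelCount_eq_zero_of_lt (A : Finset (Config E)) {w : ℕ} (hw : Fintype.card E < w) :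
    levelCount A w = 0 := by
  unfold levelCount
  rw [Finset.card_eq_zero, Finset.filter_eq_empty_iff]
  intro ω _ h
  have := Finset.card_le_univ (openEdges ω)
  omega

end Levels

namespace MultiGraph

variable {V E : Type*} (G : MultiGraph V E) [DecidableEq V] [Fintype V] [Fintype E] [DecidableEq E]

/-- `T`: the three marks are all connected. -/
def allConn3 (a b c : V) : Finset (Config E) :=
  Finset.univ.filter fun ω => G.Conn ω a b ∧ G.Conn ω b c ∧ G.Conn ω a c

/-- `B`: the three marks are pairwise separated. -/
def allSep3 (a b c : V) : Finset (Config E) :=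
  Finset.univ.filter fun ω => ¬ G.Conn ω a b ∧ ¬ G.Conn ω b c ∧ ¬ G.Conn ω a c

/-- `Y`: exactly one pair of the three marks is connected — neither all connected nor all
separated (connectivity is an equivalence, so two connected pairs force the third). -/
def onePair3 (a b c : V) : Finset (Config E) :=
  Finset.univ.filter fun ω =>
    ¬ (G.Conn ω a b ∧ G.Conn ω b c ∧ G.Conn ω a c) ∧
      ¬ (¬ G.Conn ω a b ∧ ¬ G.Conn ω b c ∧ ¬ G.Conn ω a c)

/-- The level-`k` inequality of COUNT-NAN3 for the marks `a, b, c`. -/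
def countNAN3Level (a b c : V) (k : ℕ) : Prop :=
  3 * (∑ j ∈ Finset.range (k + 1),
      levelCount (G.allConn3 a b c) j * levelCount (G.allSep3 a b c) (k - j)) ≤
    ∑ j ∈ Finset.range (k + 1), levelCount (G.onePair3 a b c) j * Nat.choose (Fintype.card E) (k - j)

/-- The level inequality is decidable on finite data. -/
instance (a b c : V) (k : ℕ) : Decidable (G.countNAN3Level a b c k) := by
  unfold countNAN3Level; infer_instance

/-- **COUNT-NAN3 for one marked multigraph** (mine-2 row M2-8): for every level `k`,
`3 · Σ_j N_j(T) · N_{k−j}(B) ≤ Σ_j N_j(Y) · C(m, k − j)` with `m = |E|`. -/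
def CountNAN3 (a b c : V) : Prop := ∀ k : ℕ, G.countNAN3Level a b c k

/-- The bounded form: the levels `k ≤ 2·|E|` only. -/
def CountNAN3Upto (a b c : V) : Prop :=
  ∀ k ∈ Finset.range (2 * Fintype.card E + 1), G.countNAN3Level a b c k

/-- The bounded form is decidable on finite data. -/
instance (a b c : V) : Decidable (G.CountNAN3Upto a b c) := by
  unfold CountNAN3Upto; infer_instance

/-- Above level `2·|E|` the left-hand side vanishes (one factor of every product is an empty
level), so the bounded form is the whole row. -/
theorem countNAN3_iff_upto (a b c : V) : G.CountNAN3 a b c ↔ G.CountNAN3Upto a b c := by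
  constructor
  · intro h k _
    exact h k
  · intro h k
    by_cases hk : k ≤ 2 * Fintype.card E
    · exact h k (Finset.mem_range.mpr (by omega))
    · unfold countNAN3Level
      have hL : (∑ j ∈ Finset.range (k + 1),
          levelCount (G.allConn3 a b c) j * levelCount (G.allSep3 a b c) (k - j)) = 0 := by
        refine Finset.sum_eq_zero fun j hj => ?_
        by_cases hj' : Fintype.card E < j
        · rw [levelCount_eq_zero_of_lt _ hj', zero_mul]
        · rw [levelCount_eq_zero_of_lt _ (by omega : Fintype.card E < k - j), mul_zero]
      rw [hL, mul_zero]
      exact Nat.zero_le _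

end MultiGraph

/-- **C-020 = COUNT-NAN3** (mine-2 row M2-8; CONJECTURES v44): every finite multigraph, every three
marks satisfy the count inequality at every level. -/
def C020 : Prop :=
  ∀ {V E : Type} [Fintype V] [DecidableEq V] [Fintype E] [DecidableEq E] (G : MultiGraph V E)
    (a b c : V), G.CountNAN3 a b c

/-- The tight instance: the marked triangle `K₃` (mine-2: ratio exactly 3 at level 2), decided. -/
theorem countNAN3Upto_triangle : Examples.triangle.CountNAN3Upto 0 1 2 := by decide

/-- The marked triangle satisfies the whole row. -/
theorem countNAN3_triangle : Examples.triangle.CountNAN3 0 1 2 :=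
  (Examples.triangle.countNAN3_iff_upto 0 1 2).mpr countNAN3Upto_triangle

/-- The path `P₃` (`0 — 1 — 2`, typer-1's `path2`), decided. -/
theorem countNAN3Upto_path2 : Examples.path2.CountNAN3Upto 0 1 2 := by decide

/-- The path `P₃` satisfies the whole row. -/
theorem countNAN3_path2 : Examples.path2.CountNAN3 0 1 2 :=
  (Examples.path2.countNAN3_iff_upto 0 1 2).mpr countNAN3Upto_path2

end PercRepro
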